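import Summits.BirchSwinnertonDyer.BirchSwinnertonDyer.Theorems.PrintX11aUpperNonSurjFiveExcToolkitRoots
import HarnessLib

/-!
# Crux U5 `PrintX11a.UpperNonSurjFive` (item stmt-BirchSwinnertonDyer-20614), line «gl1cartan5», EXCEPTIONAL-ZERO road:
# the `k`-FOLD STABILISATION of the optimal-level newform at a squarefree set of primes `D` (which may contain `p`), general `p`

Cell `bsd-print-x11a`, seat `cruxlead-stmt-BirchSwinnertonDyer-20614` (LEAD g6); `--supports stmt-BirchSwinnertonDyer-20614`,
closes nothing. File 3 of the EXCEPTIONAL-ZERO road: the bsd-addord acc2 theorem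
`KimAtThreeDeepLowerOffStratumLevelLoweringMultiStabData.exists_multiStab` (Vatsal data of the iterated stabilisation
`(∏_{ℓ ∣ D} (ι₁ − β_ℓ ι_ℓ)) g` of a newform `g ∈ S₂(Γ₀(M₀))`, `D` squarefree prime to `M₀`, signs `u_ℓ = ±1` with
`a_ℓ(g) ≡ u_ℓ(ℓ + 1)`, roots `β_ℓ ≡ u_ℓ ℓ`, `α_ℓ ≠ β_ℓ` by Coleman–Edixhoven BY NAME) RE-PROVED over `ℚ̄_p = PadicAlgCl p` for an
arbitrary prime `p` — proof copied letter for letter, the `𝔭`-adic lemmas now those of `…ExcToolkit{,Roots}`; the `p`-free inputs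
(`…MultiStabConditionOne`, `…StabEigenform`, `…ConditionOne`, `iota_mem_span_realEigen`) are imported. On the exceptional-zero road
`D = p·D′` CONTAINS the residue characteristic: at `ℓ = p` the sign is `u_p = a_p(E)` (`= 1` at a split multiplicative `p`), the root
`β_p ≡ u_p·p ≡ 0` and the ordinary root `α_p ≡ u_p` — nothing in the induction distinguishes `ℓ = p` from `ℓ ≠ p`. Theorems only; no
definition, no named fact, no `sorry`; BSD is not proved by any of this.

## References

* F. Diamond, J. Shurman (2005), §5.7, Prop. 5.6.2, Prop. 5.8.5 [DiamondShurman2005]; V. Vatsal, Duke Math. J. 98 (1999), (1.2)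
  Condition 1 [Vatsal1999]; R. F. Coleman, B. Edixhoven, Math. Ann. 310 (1998), Thm. 2.1 [ColemanEdixhoven1998]; R. Greenberg,
  V. Vatsal, Invent. Math. 142 (2000), §3 Lemma (3.6) [GreenbergVatsal2000]; G. Shimura (1971), Thm. 3.48 [Shimura1971].
-/

set_option autoImplicit false
-- the Theorems namespace of a single-conjunct summit repeats the summit name by design (D-0017)
set_option linter.dupNamespace false

noncomputable section

open scoped MatrixGroups ModularForm Classical NNReal

open CongruenceSubgroup WeierstrassCurve Literature.NumberTheory.EllipticCurves
  Literature.NumberTheory.EllipticCurves.ModularForms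
open UpperHalfPlane hiding I

namespace Summit.BirchSwinnertonDyer.BirchSwinnertonDyer.Theorems.GL1Cartan.Exc

open Summit.BirchSwinnertonDyer.BirchSwinnertonDyer.Theorems.KimAtThreeDeepLowerOffStratumLevelLoweringConditionOne
  (hasSimpleHeckeGenEigenspace_of_isNewform0)
open Summit.BirchSwinnertonDyer.BirchSwinnertonDyer.Theorems.KimAtThreeDeepLowerOffStratumLevelLoweringVatsalStab
  (cuspCoeff_stab isNormalized_stab)
open Summit.BirchSwinnertonDyer.BirchSwinnertonDyer.Theorems.KimAtThreeDeepLowerOffStratumLevelLoweringStabEigenform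
  renaming heckeT_stab_of_ne → heckeT_stab_of_ne_eig, heckeT_stab_self → heckeT_stab_self_eig,
    isHeckeEigenform_stab → isHeckeEigenform_stab_eig, cuspCoeff_stab_prime → cuspCoeff_stab_prime_eig,
    cuspCoeff_mul_cuspCoeff → cuspCoeff_mul_cuspCoeff_eig, heckeEigenvalue_stab → heckeEigenvalue_stab_eig,
    valuation_cuspCoeff_stab_le_one → valuation_cuspCoeff_stab_le_one_three,
    finiteDimensional_coeffField_stab → finiteDimensional_coeffField_stab_eig
open Summit.BirchSwinnertonDyer.BirchSwinnertonDyer.Theorems.KimAtThreeDeepLowerOffStratumLevelLoweringStabCanonicalPeriod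
  (cuspCoeff_iota_im_eq_zero)
open Summit.BirchSwinnertonDyer.BirchSwinnertonDyer.Theorems.KimAtThreeDeepLowerOffStratumLevelLoweringMultiStabConditionOne
  (hasSimpleHeckeGenEigenspace_stab_of_hasSimpleHeckeGenEigenspace)
open Summit.BirchSwinnertonDyer.BirchSwinnertonDyer.Theorems.KimAtThreeDeepLowerOffStratumLevelLoweringMultiStabData
  (iota_mem_span_realEigen)

section Induction

variable {p : ℕ} [Fact p.Prime] {M₀ : ℕ} [NeZero M₀] {g : CuspForm (Gamma0 M₀) 2} (hg : IsNewform0 g)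
include hg

/-- ★ **THE `k`-FOLD STABILISATION of the optimal-level newform.** Let `g ∈ S₂(Γ₀(M₀))` be a newform, `D`
squarefree and prime to `M₀`, and suppose that at every prime `p ∣ D` there is a sign `u_p = ±1` with `af p = u_p`
and `a_p(g) ≡ u_p (p + 1)` (mod `𝔪`, through `ι⁻¹`). Then (Coleman–Edixhoven BY NAME for `α ≠ β`) at level
`L = M₀ D` there is a normalised Hecke eigenform `G` with `p`-integral coefficients in a number field, satisfying
Vatsal's Condition 1, `a_p(G) = a_p(g)` for primes `p ∤ D`, `a_p(G) ≡ af p` for primes `p ∣ D`, lying in the complex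
span of the real-coefficient forms of level `L` on which every `T_r`, `r ∤ L`, acts by `a_r(g)`: the iterated
stabilisation `(∏_{p ∣ D} (ι₁ − β_p ι_p)) g`, `β_p ≡ u_p p`, built one prime at a time.
[cite: Vatsal1999, (1.2) Condition 1] [cite: ColemanEdixhoven1998, Thm. 2.1] [cite: DiamondShurman2005, §5.7 and Prop. 5.6.2]
[cite: Shimura1971, Thm. 3.48] -/
theorem exists_multiStab (ι : PadicAlgCl p ≃+* ℂ) (af : ℕ → ℂ) (hCE : colemanEdixhoven1998_heckePolynomial_simpleRoots) :
    ∀ (D : ℕ), Squarefree D → Nat.Coprime D M₀ →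
      (∀ q : ℕ, q.Prime → q ∣ D → ∃ u : ℤ, u * u = 1 ∧ af q = u ∧
        Valued.v (ι.symm (cuspCoeff g q - u * (q + 1))) < 1) →
      ∀ (L : ℕ) [NeZero L], L = M₀ * D →
        ∃ G : CuspForm (Gamma0 L) 2,
          IsHeckeEigenform G ∧ IsNormalized G ∧ (∀ n : ℕ, Valued.v (ι.symm (cuspCoeff G n)) ≤ 1) ∧
          FiniteDimensional ℚ (coeffField G) ∧ HasSimpleHeckeGenEigenspace G ∧
          (∀ q : ℕ, q.Prime → ¬ q ∣ D → cuspCoeff G q = cuspCoeff g q) ∧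
          (∀ q : ℕ, q.Prime → q ∣ D → Valued.v (ι.symm (af q - cuspCoeff G q)) < 1) ∧
          G ∈ Submodule.span ℂ {ψ : CuspForm (Gamma0 L) 2 | (∀ m, (cuspCoeff ψ m).im = 0) ∧
            ∀ (r : ℕ) (hr : r.Prime), ¬ r ∣ L →
              (haveI : NeZero r := ⟨hr.ne_zero⟩; heckeT (Gamma0 L) 2 r ψ) = cuspCoeff g r • ψ} := by
  intro D
  induction D using Nat.strong_induction_on with
  | _ D ih =>
    intro hDsq hDM₀ hDat L _ hL
    by_cases hD1 : D = 1
    · -- base: `D = 1`, `G = g`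
      subst hD1
      obtain rfl : L = M₀ := by rw [hL, mul_one]
      refine ⟨g, hg.2.1, hg.2.2, valuation_cuspCoeff_le_one_of_isNewform0 hg ι,
        IsNewform0.finiteDimensional_coeffField_holds hg, hasSimpleHeckeGenEigenspace_of_isNewform0 hg,
        fun q _ _ ↦ rfl, fun q hp hp1 ↦ absurd (Nat.eq_one_of_dvd_one hp1) hp.ne_one, ?_⟩
      refine Submodule.subset_span ⟨hg.cuspCoeff_im_eq_zero, fun r hr _ ↦ ?_⟩
      haveI : NeZero r := ⟨hr.ne_zero⟩
      exact hg.heckeT_eq_coeff_smul hr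
    · -- step: `D = ℓ D'` with `ℓ` prime, `ℓ ∤ D'`
      obtain ⟨ℓ, hℓ, hℓD⟩ := Nat.exists_prime_and_dvd hD1
      obtain ⟨D', rfl⟩ := hℓD
      have hsq := Nat.squarefree_mul_iff.mp hDsq
      obtain ⟨hℓD', -, hD'sq⟩ := hsq
      have hℓD'' : ¬ ℓ ∣ D' := fun h ↦ hℓ.ne_one (Nat.Coprime.eq_one_of_dvd hℓD' h)
      have hD'M₀ : Nat.Coprime D' M₀ := Nat.Coprime.coprime_dvd_left (dvd_mul_left D' ℓ) hDM₀
      have hℓM₀ : ¬ ℓ ∣ M₀ := fun h ↦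
        hℓ.ne_one (Nat.Coprime.eq_one_of_dvd (Nat.Coprime.coprime_dvd_left (dvd_mul_right ℓ D') hDM₀) h)
      have hD'0 : D' ≠ 0 := Squarefree.ne_zero hD'sq
      haveI : NeZero D' := ⟨hD'0⟩
      haveI : NeZero ℓ := ⟨hℓ.ne_zero⟩
      have hD'lt : D' < ℓ * D' := by
        have := hℓ.two_le
        have hpos := Nat.pos_of_ne_zero hD'0
        nlinarith
      -- the form at level `M₀ D'`
      obtain ⟨G', hG'eig, hG'norm, hG'int, hG'fd, hG'C, hG'g, hG'f, hG'span⟩ :=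
        ih D' hD'lt hD'sq hD'M₀ (fun q hp hpD' ↦ hDat q hp (hpD'.mul_left ℓ)) (M₀ * D') rfl
      have hℓL' : ¬ ℓ ∣ M₀ * D' := by
        intro h
        rcases (Nat.Prime.dvd_mul hℓ).mp h with h | h
        · exact hℓM₀ h
        · exact hℓD'' h
      have hM₀L' : M₀ ∣ M₀ * D' := dvd_mul_right M₀ D'
      have h1 : M₀ * D' * 1 ∣ M₀ * D' * ℓ := mul_dvd_mul_left _ (one_dvd ℓ)
      have hℓℓ : M₀ * D' * ℓ ∣ M₀ * D' * ℓ := dvd_rfl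
      -- the root `β ≡ uℓ` and `α ≠ β`
      obtain ⟨u, hu, hafℓ, haℓ⟩ := hDat ℓ hℓ (dvd_mul_right ℓ D')
      have hGℓ : cuspCoeff G' ℓ = cuspCoeff g ℓ := hG'g ℓ hℓ hℓD''
      rw [← hGℓ] at haℓ
      obtain ⟨β, hβ, -, hα⟩ := exists_root_valuation_sub_lt_one_sign ι (hG'int ℓ) ℓ hu haℓ
      have hne : cuspCoeff G' ℓ - β ≠ β :=
        colemanEdixhoven1998_heckePolynomial_simpleRoots.root_ne hCE hg hℓ hℓM₀
          (by rw [← hGℓ]; exact sub_add_cancel _ β) (by linear_combination -hβ)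
      -- the data of the new form `G = ι₁ G' − β ι_ℓ G'` at level `M₀ D' ℓ = L`
      have hGeig : IsHeckeEigenform (iota (M₀ * D') (M₀ * D' * ℓ) 1 2 h1 G' - β • iota (M₀ * D') (M₀ * D' * ℓ) ℓ 2 hℓℓ G') :=
        isHeckeEigenform_stab_eig hG'eig hG'norm β h1 hℓℓ hℓ hℓL' hβ
      have hGnorm : IsNormalized (iota (M₀ * D') (M₀ * D' * ℓ) 1 2 h1 G' - β • iota (M₀ * D') (M₀ * D' * ℓ) ℓ 2 hℓℓ G') :=
        isNormalized_stab G' β h1 hℓℓ hG'norm hℓ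
      have hGint : ∀ n : ℕ, Valued.v (ι.symm (cuspCoeff
          (iota (M₀ * D') (M₀ * D' * ℓ) 1 2 h1 G' - β • iota (M₀ * D') (M₀ * D' * ℓ) ℓ 2 hℓℓ G') n)) ≤ 1 :=
        valuation_cuspCoeff_stab_le_one ι β h1 hℓℓ hG'int hβ
      have hGfd : FiniteDimensional ℚ
          (coeffField (iota (M₀ * D') (M₀ * D' * ℓ) 1 2 h1 G' - β • iota (M₀ * D') (M₀ * D' * ℓ) ℓ 2 hℓℓ G')) :=
        finiteDimensional_coeffField_stab_eig β h1 hℓℓ hG'fd hβ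
      have hGC : HasSimpleHeckeGenEigenspace
          (iota (M₀ * D') (M₀ * D' * ℓ) 1 2 h1 G' - β • iota (M₀ * D') (M₀ * D' * ℓ) ℓ 2 hℓℓ G') :=
        hasSimpleHeckeGenEigenspace_stab_of_hasSimpleHeckeGenEigenspace hg h1 hℓℓ hM₀L' hG'eig hG'norm hG'C
          (fun q hp hpL' ↦ hG'g q hp fun h ↦ hpL' (h.mul_left M₀)) hℓ hℓL' hβ hne
      have hGp : ∀ {q : ℕ}, q.Prime →
          cuspCoeff (iota (M₀ * D') (M₀ * D' * ℓ) 1 2 h1 G' - β • iota (M₀ * D') (M₀ * D' * ℓ) ℓ 2 hℓℓ G') q =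
            if q = ℓ then cuspCoeff G' ℓ - β else cuspCoeff G' q :=
        fun hp ↦ cuspCoeff_stab_prime_eig hG'norm β h1 hℓℓ hℓ hp
      have hGspan : ∀ {d : ℕ} [NeZero d] (hd : M₀ * D' * d ∣ M₀ * D' * ℓ), d = 1 ∨ d = ℓ →
          iota (M₀ * D') (M₀ * D' * ℓ) d 2 hd G' ∈ Submodule.span ℂ {ψ' : CuspForm (Gamma0 (M₀ * D' * ℓ)) 2 |
            (∀ m, (cuspCoeff ψ' m).im = 0) ∧ ∀ (r : ℕ) (hr : r.Prime), ¬ r ∣ M₀ * D' * ℓ →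
              (haveI : NeZero r := ⟨hr.ne_zero⟩; heckeT (Gamma0 (M₀ * D' * ℓ)) 2 r ψ') = cuspCoeff g r • ψ'} := by
        intro d _ hd hdℓ
        refine (Submodule.map_span_le (iota (M₀ * D') (M₀ * D' * ℓ) d 2 hd) _ _ |>.mpr ?_)
          (Submodule.mem_map_of_mem hG'span)
        rintro ψ ⟨hreal, hT⟩
        exact iota_mem_span_realEigen (fun r ↦ cuspCoeff g r) hℓ hd hdℓ hreal hT
      obtain rfl : L = M₀ * D' * ℓ := by rw [hL]; ring
      refine ⟨iota (M₀ * D') (M₀ * D' * ℓ) 1 2 h1 G' - β • iota (M₀ * D') (M₀ * D' * ℓ) ℓ 2 hℓℓ G',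
        hGeig, hGnorm, hGint, hGfd, hGC, fun q hp hpD ↦ ?_, fun q hp hpD ↦ ?_,
        Submodule.sub_mem _ (hGspan h1 (Or.inl rfl)) (Submodule.smul_mem _ _ (hGspan hℓℓ (Or.inr rfl)))⟩
      · -- `a_p(G) = a_p(g)` off `D = ℓ D'`
        have hpℓ : q ≠ ℓ := by rintro rfl; exact hpD (dvd_mul_right q D')
        have hpD' : ¬ q ∣ D' := fun h ↦ hpD (h.mul_left ℓ)
        rw [hGp hp, if_neg hpℓ, hG'g q hp hpD']
      · -- `a_p(G) ≡ af q` on `D`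
        rw [hGp hp]
        by_cases hpℓ : q = ℓ
        · subst hpℓ
          rw [if_pos rfl, hafℓ]
          have : ι.symm ((u : ℂ) - (cuspCoeff G' q - β)) = -ι.symm (cuspCoeff G' q - β - u) := by
            rw [← map_neg]; congr 1; ring
          rw [this, Valuation.map_neg]
          exact hα
        · rw [if_neg hpℓ]
          have hpD' : q ∣ D' := by
            rcases (Nat.Prime.dvd_mul hp).mp hpD with h | h
            · exact absurd ((Nat.prime_dvd_prime_iff_eq hp hℓ).mp h) hpℓ
            · exact h
          exact hG'f q hp hpD'

end Induction

end Summit.BirchSwinnertonDyer.BirchSwinnertonDyer.Theorems.GL1Cartan.Exc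

end
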